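import Literature.NumberTheory.LFunctions.IncompleteKloostermanSmooth
import HarnessLib

/-!
# Drappeau 2017, §4.3.3, display (4.33): Poisson summation in `d` and completion to Kloosterman sums

Topic `Literature/NumberTheory/Sieve`.  First step of the proof of S. Drappeau, *Sums of Kloosterman
sums in arithmetic progressions, and the error term in the dispersion method*, Proc. LMS (3) 114
(2017) 684–732 = arXiv:1504.05549, Theorem 2.1 (= Assing–Blomer–Li 2021, Theorem 2.3 at `a = 1`,
the named fact `Literature.NumberTheory.Sieve.AssingBlomerLi2020_theorem23`) from Proposition 4.13
(§4.3.3, p. 15 of the arXiv version): for fixed `c, n, r, s` with `(qr, sc) = 1` and a smooth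
compactly supported `F` (the weight `d ↦ g(c,d,n,r,s)`),

`∑_{d ≡ d₀ (q), (d, sc) = 1} F(d) e(n·\overline{rd}/(sc))
   = (1/(q·sc)) ∑_{h ∈ ℤ} 𝓕F(h/(q·sc)) · e(h d₀ \overline{sc}/q) · S(h q̄, n r̄; sc)`,

`S` the complete Kloosterman sum, `q̄, r̄` inverses modulo `sc`, `\overline{sc}` the inverse of `sc`
modulo `q` (Drappeau's (4.33), with Mathlib's Fourier transform `𝓕F(ξ) = ∫ F(x) e(−xξ) dx`, so that
the frequency `h` here is `−m` there; the phase `e(h d₀ \overline{sc}/q)` only depends on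
`sc mod q`, which is why Drappeau fixes `s ≡ s₀ (mod q)`).  Ingredients, all in the tree: Poisson
summation twisted by a periodic function (`MatomakiMerikoski2023_lemma34`,
`PoissonTwistedProgression.lean`), the completion of the reduced residues modulo `sc` in a fixed
class modulo `q` to a Kloosterman sum (the exact form of `MatomakiMerikoski.norm_completeSum_eq`),
and the reciprocity `1/(q·sc) ≡ q̄/(sc) + \overline{sc}/q (mod 1)`.

Everything PROVED (no named fact, no new definition, standard axioms):

* `exact_completeSum_eq` — `∑_{j<d} 1_{(α+qj,d)=1} e_d(c·\overline{α+qj}) e((α+qj)h/(qd))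
  = e(αh/(qd)) e_d(−h q̄ α) S(h q̄, c; d)`;
* `fourierChar_reciprocity` — `e(αh/(qd)) e_d(−h q̄ α) = e(h α d̄/q)`, `d̄ = d⁻¹ (mod q)`;
* `sum_Icc_modEq_eq_tsum` — a sum over `1 ≤ d ≤ L`, `d ≡ d₀ (q)` as a sum over the progression;
* `poisson_completion` — the displayed identity.

## References

* S. Drappeau, Proc. LMS (3) 114 (2017) 684–732, arXiv:1504.05549, §4.3.3 display (4.33).
  [cite: Drappeau2017, §4.3.3 (4.33)]
* K. Matomäki, J. Merikoski, Compos. Math. 159 (2023), proof of Lemma 3.8 / Lemma 3.4.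
  [cite: MatomakiMerikoski2023, Lemma 3.4 and (3.9)]
-/

noncomputable section

open Real MeasureTheory Filter Complex Finset
open scoped FourierTransform Topology ContDiff

namespace Literature.NumberTheory.Sieve

namespace KloostermanQuintilinear

open Literature.NumberTheory.LFunctions (kloostermanSum sum_zmod_eq_sum_range)
open Literature.NumberTheory.LFunctions.MatomakiMerikoski (MatomakiMerikoski2023_lemma34)
open Literature.NumberTheory.Sieve.RamanujanSum (fourierChar_intCast)

/-! ### The complete sum, exactly -/

/-- **Completion, exact form** (cf. `MatomakiMerikoski.norm_completeSum_eq`, which records only the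
modulus): for `(q, d) = 1`, `q̄ = q⁻¹ (mod d)`, `h, α ∈ ℤ`, `c ∈ ℤ/d`,
`∑_{0 ≤ j < d} 1_{(α+qj, d)=1} e_d(c·\overline{α+qj}) e((α+qj)h/(qd)) = e(αh/(qd)) e_d(−h q̄ α) S(h q̄, c; d)`.
[cite: MatomakiMerikoski2023, proof of Lemma 3.8, (3.9)] -/
theorem exact_completeSum_eq {d q : ℕ} [NeZero d] (hq : 0 < q) (hqd : q.Coprime d) (α h : ℤ)
    (c : ZMod d) :
    ∑ j ∈ Finset.range d,
        (if IsUnit ((α + q * j : ℤ) : ZMod d) then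
            (ZMod.stdAddChar (c * ((α + q * j : ℤ) : ZMod d)⁻¹) : ℂ) else 0) *
          (𝐞 (((α + q * j : ℤ) : ℝ) * h / (q * d : ℕ)) : ℂ) =
      (𝐞 ((α : ℝ) * h / (q * d : ℕ)) : ℂ) *
        (ZMod.stdAddChar (-((h : ZMod d) * (q : ZMod d)⁻¹ * (α : ZMod d))) : ℂ) *
        kloostermanSum d ((h : ZMod d) * (q : ZMod d)⁻¹) c := by
  classical
  have hd0 : 0 < d := Nat.pos_of_ne_zero (NeZero.ne d)
  have hqd' : IsUnit (q : ZMod d) := (ZMod.isUnit_iff_coprime q d).mpr hqd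
  set qi : ZMod d := (q : ZMod d)⁻¹ with hqi
  have hqqi : (q : ZMod d) * qi = 1 := ZMod.mul_inv_of_unit _ hqd'
  -- Step 1: factor `e(h(α + qj)/(qd)) = e(hα/(qd)) · e_d(hj)`
  have hphase : ∀ j : ℕ, (𝐞 (((α + q * j : ℤ) : ℝ) * h / (q * d : ℕ)) : ℂ) =
      (𝐞 ((α : ℝ) * h / (q * d : ℕ)) : ℂ) * (ZMod.stdAddChar ((h : ZMod d) * (j : ZMod d)) : ℂ) := by
    intro j
    have e1 : (h : ZMod d) * (j : ZMod d) = (((h * j : ℤ)) : ZMod d) := by push_cast; ring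
    rw [e1, ZMod.stdAddChar_coe, Real.fourierChar_apply, Real.fourierChar_apply, ← Complex.exp_add]
    congr 1
    have hq0 : (q : ℂ) ≠ 0 := by exact_mod_cast hq.ne'
    have hd0' : (d : ℂ) ≠ 0 := by exact_mod_cast hd0.ne'
    push_cast
    field_simp
  -- Step 2: the summand as a function on `ℤ/d` of `j`
  set Φ : ZMod d → ℂ := fun x =>
    (if IsUnit ((α : ZMod d) + (q : ZMod d) * x) then
        (ZMod.stdAddChar (c * ((α : ZMod d) + (q : ZMod d) * x)⁻¹) : ℂ) else 0) *
      (ZMod.stdAddChar ((h : ZMod d) * x) : ℂ) with hΦ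
  have hsummand : ∀ j : ℕ,
      (if IsUnit ((α + q * j : ℤ) : ZMod d) then
          (ZMod.stdAddChar (c * ((α + q * j : ℤ) : ZMod d)⁻¹) : ℂ) else 0) *
        (𝐞 (((α + q * j : ℤ) : ℝ) * h / (q * d : ℕ)) : ℂ) =
      (𝐞 ((α : ℝ) * h / (q * d : ℕ)) : ℂ) * Φ (j : ZMod d) := by
    intro j
    rw [hphase j]
    have hcast : ((α + q * j : ℤ) : ZMod d) = (α : ZMod d) + (q : ZMod d) * (j : ZMod d) := by
      push_cast; ring
    simp only [hΦ, hcast]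
    ring
  rw [Finset.sum_congr rfl fun j _ => hsummand j, ← Finset.mul_sum, ← sum_zmod_eq_sum_range Φ]
  -- Step 3: substitute `β = α + q x` (an affine bijection of `ℤ/d`)
  have hbij : ∑ x : ZMod d, Φ x =
      ∑ β : ZMod d, (if IsUnit β then (ZMod.stdAddChar (c * β⁻¹) : ℂ) else 0) *
        (ZMod.stdAddChar ((h : ZMod d) * (qi * (β - (α : ZMod d)))) : ℂ) := by
    refine Finset.sum_nbij' (fun x => (α : ZMod d) + (q : ZMod d) * x)
      (fun β => qi * (β - (α : ZMod d)))
      (fun _ _ => Finset.mem_univ _) (fun _ _ => Finset.mem_univ _) (fun x _ => ?_) (fun β _ => ?_)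
      (fun x _ => ?_)
    · calc qi * ((α : ZMod d) + (q : ZMod d) * x - (α : ZMod d)) = ((q : ZMod d) * qi) * x := by ring
        _ = x := by rw [hqqi, one_mul]
    · calc (α : ZMod d) + (q : ZMod d) * (qi * (β - (α : ZMod d)))
          = (α : ZMod d) + ((q : ZMod d) * qi) * (β - (α : ZMod d)) := by ring
        _ = β := by rw [hqqi]; ring
    · simp only [hΦ]
      congr 2
      calc (h : ZMod d) * x = (h : ZMod d) * (((q : ZMod d) * qi) * x) := by rw [hqqi, one_mul]
        _ = (h : ZMod d) * (qi * ((α : ZMod d) + (q : ZMod d) * x - (α : ZMod d))) := by ring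
  rw [hbij]
  -- Step 4: pull out the phase `e_d(-h qi α)` and recognise `S(h qi, c; d)`
  have hsplit : ∀ β : ZMod d, (ZMod.stdAddChar ((h : ZMod d) * (qi * (β - (α : ZMod d)))) : ℂ) =
      (ZMod.stdAddChar (-((h : ZMod d) * qi * (α : ZMod d))) : ℂ) *
        (ZMod.stdAddChar ((h : ZMod d) * qi * β) : ℂ) := by
    intro β
    rw [← AddChar.map_add_eq_mul]
    congr 1; ring
  simp_rw [hsplit]
  have hre : ∑ β : ZMod d, (if IsUnit β then (ZMod.stdAddChar (c * β⁻¹) : ℂ) else 0) *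
        ((ZMod.stdAddChar (-((h : ZMod d) * qi * (α : ZMod d))) : ℂ) *
          (ZMod.stdAddChar ((h : ZMod d) * qi * β) : ℂ)) =
      (ZMod.stdAddChar (-((h : ZMod d) * qi * (α : ZMod d))) : ℂ) *
        kloostermanSum d ((h : ZMod d) * qi) c := by
    unfold kloostermanSum
    rw [Finset.mul_sum]
    refine Finset.sum_congr rfl fun β _ => ?_
    split_ifs with hβ
    · rw [← AddChar.map_add_eq_mul, ← AddChar.map_add_eq_mul, ← AddChar.map_add_eq_mul]
      congr 1; ring
    · simp
  rw [hre]
  ring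

/-! ### Reciprocity for the phase -/

/-- `e(x + k) = e(x)` for an integer `k`. [folklore] -/
private theorem fourierChar_add_int (x : ℝ) (k : ℤ) : (𝐞 (x + k) : ℂ) = 𝐞 x := by
  rw [AddChar.map_add_eq_mul, Circle.coe_mul, fourierChar_intCast, mul_one]

/-- `e_d` of an integer `j` is `e(j/d)`. [folklore] -/
private theorem stdAddChar_intCast_eq_fourierChar {d : ℕ} [NeZero d] (j : ℤ) :
    (ZMod.stdAddChar (j : ZMod d) : ℂ) = 𝐞 ((j : ℝ) / d) := by
  rw [ZMod.stdAddChar_coe, Real.fourierChar_apply]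
  congr 1
  push_cast
  ring

/-- **Reciprocity** `1/(qd) ≡ q̄/d + d̄/q (mod 1)` in the form needed: for `(q, d) = 1`,
`e(αh/(qd)) · e_d(−h q̄ α) = e(h α d̄ / q)` with `q̄ = q⁻¹ (mod d)`, `d̄ = d⁻¹ (mod q)`. [folklore] -/
theorem fourierChar_reciprocity {d q : ℕ} [NeZero d] (hq : 0 < q) (hqd : q.Coprime d) (α h : ℤ) :
    (𝐞 ((α : ℝ) * h / (q * d : ℕ)) : ℂ) *
        (ZMod.stdAddChar (-((h : ZMod d) * (q : ZMod d)⁻¹ * (α : ZMod d))) : ℂ) =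
      𝐞 ((h : ℝ) * α * ((((d : ZMod q)⁻¹).val : ℕ) : ℝ) / q) := by
  haveI : NeZero q := ⟨hq.ne'⟩
  have hd0 : 0 < d := Nat.pos_of_ne_zero (NeZero.ne d)
  set qi : ℕ := ((q : ZMod d)⁻¹).val with hqi
  set di : ℕ := ((d : ZMod q)⁻¹).val with hdi
  -- `q qi ≡ 1 (mod d)` and `d di ≡ 1 (mod q)`
  have hqqi : ((q * qi : ℕ) : ZMod d) = 1 := by
    rw [Nat.cast_mul, hqi, ZMod.natCast_zmod_val]
    exact ZMod.mul_inv_of_unit _ ((ZMod.isUnit_iff_coprime q d).mpr hqd)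
  have hddi : ((d * di : ℕ) : ZMod q) = 1 := by
    rw [Nat.cast_mul, hdi, ZMod.natCast_zmod_val]
    exact ZMod.mul_inv_of_unit _ ((ZMod.isUnit_iff_coprime d q).mpr hqd.symm)
  -- the integer `E = 1 - q qi - d di` is divisible by `q d`
  have hdvd_d : (d : ℤ) ∣ (1 - q * qi - d * di : ℤ) := by
    have h1 : (d : ℤ) ∣ ((q * qi : ℕ) : ℤ) - 1 := by
      rw [← ZMod.intCast_eq_intCast_iff_dvd_sub]
      push_cast at hqqi ⊢
      rw [hqqi]
    have h2 : (d : ℤ) ∣ (d * di : ℤ) := dvd_mul_right _ _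
    have : (1 - q * qi - d * di : ℤ) = -(((q * qi : ℕ) : ℤ) - 1) - d * di := by push_cast; ring
    rw [this]
    exact dvd_sub (dvd_neg.mpr h1) h2
  have hdvd_q : (q : ℤ) ∣ (1 - q * qi - d * di : ℤ) := by
    have h1 : (q : ℤ) ∣ ((d * di : ℕ) : ℤ) - 1 := by
      rw [← ZMod.intCast_eq_intCast_iff_dvd_sub]
      push_cast at hddi ⊢
      rw [hddi]
    have h2 : (q : ℤ) ∣ (q * qi : ℤ) := dvd_mul_right _ _
    have : (1 - q * qi - d * di : ℤ) = -(((d * di : ℕ) : ℤ) - 1) - q * qi := by push_cast; ring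
    rw [this]
    exact dvd_sub (dvd_neg.mpr h1) h2
  have hcop : IsCoprime (q : ℤ) (d : ℤ) := Nat.isCoprime_iff_coprime.mpr hqd
  obtain ⟨t, ht⟩ : (q : ℤ) * d ∣ (1 - q * qi - d * di : ℤ) := hcop.mul_dvd hdvd_q hdvd_d
  -- decompose `αh/(qd)`
  have hq0 : (q : ℝ) ≠ 0 := by exact_mod_cast hq.ne'
  have hd0' : (d : ℝ) ≠ 0 := by exact_mod_cast hd0.ne'
  have hdecomp : (α : ℝ) * h / (q * d : ℕ) =
      (h : ℝ) * α * (di : ℝ) / q + (((α * h * qi : ℤ) : ℝ) / d + ((α * h * t : ℤ) : ℝ)) := by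
    have ht' : (1 : ℝ) - q * qi - d * di = q * d * t := by exact_mod_cast ht
    push_cast
    field_simp
    linear_combination (α : ℝ) * h * ht'
  rw [hdecomp, AddChar.map_add_eq_mul, Circle.coe_mul, fourierChar_add_int,
    ← stdAddChar_intCast_eq_fourierChar (d := d)]
  -- `e_d(αh qi) · e_d(-h q̄ α) = 1`
  have hcast : ((α * h * qi : ℤ) : ZMod d) = (h : ZMod d) * (q : ZMod d)⁻¹ * (α : ZMod d) := by
    push_cast
    rw [hqi, ZMod.natCast_zmod_val]
    ring
  rw [hcast, mul_assoc, ← AddChar.map_add_eq_mul, add_neg_cancel, AddChar.map_zero_eq_one, mul_one]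

/-! ### Sums over a residue class as sums over the progression -/

/-- A finitely supported sum over `1 ≤ d ≤ L`, `d ≡ d₀ (mod q)` is the sum of `Φ(d₀ + qk)` over
`k ∈ ℤ`, when `Φ` vanishes at the integers outside `[1, L]`. [folklore] -/
theorem sum_Icc_modEq_eq_tsum {Φ : ℤ → ℂ} {L : ℕ} (hΦ : ∀ m : ℤ, Φ m ≠ 0 → 1 ≤ m ∧ m ≤ L)
    {q : ℕ} (hq : 0 < q) (d₀ : ℕ) :
    ∑ d ∈ Finset.Icc 1 L, (if d ≡ d₀ [MOD q] then Φ d else 0) = ∑' k : ℤ, Φ (d₀ + q * k) := by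
  classical
  rw [← Finset.sum_filter]
  set T : Finset ℕ := (Finset.Icc 1 L).filter fun d => d ≡ d₀ [MOD q] with hT
  set κ : ℕ → ℤ := fun d => ((d : ℤ) - d₀) / q with hκ
  have hqz : (q : ℤ) ≠ 0 := by exact_mod_cast hq.ne'
  have hdiv : ∀ d ∈ T, (q : ℤ) ∣ (d : ℤ) - d₀ := by
    intro d hd
    rw [hT, Finset.mem_filter] at hd
    exact Int.modEq_iff_dvd.mp (Int.natCast_modEq_iff.mpr hd.2).symm
  have hback : ∀ d ∈ T, (d₀ : ℤ) + q * κ d = d := by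
    intro d hd
    simp only [hκ]
    rw [Int.mul_ediv_cancel' (hdiv d hd)]
    ring
  have hinj : Set.InjOn κ (T : Set ℕ) := by
    intro d₁ h₁ d₂ h₂ he
    have e1 := hback d₁ h₁
    have e2 := hback d₂ h₂
    have : (d₁ : ℤ) = d₂ := by rw [← e1, ← e2, he]
    exact_mod_cast this
  -- the `ℤ`-sum is supported on `κ '' T`
  have hzero : ∀ k ∉ T.image κ, Φ (d₀ + q * k) = 0 := by
    intro k hk
    by_contra hne
    obtain ⟨h1, h2⟩ := hΦ _ hne
    apply hk
    rw [Finset.mem_image]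
    obtain ⟨m, hm⟩ := Int.eq_ofNat_of_zero_le (show (0 : ℤ) ≤ d₀ + q * k by omega)
    refine ⟨m, ?_, ?_⟩
    · rw [hT, Finset.mem_filter, Finset.mem_Icc]
      refine ⟨⟨by omega, by omega⟩, ?_⟩
      rw [← Int.natCast_modEq_iff]
      exact Int.modEq_iff_dvd.mpr ⟨-k, by rw [← hm]; ring⟩
    · simp only [hκ]
      rw [← hm]
      have : ((d₀ : ℤ) + q * k - d₀) = q * k := by ring
      rw [this, Int.mul_ediv_cancel_left _ hqz]
  rw [tsum_eq_sum hzero, Finset.sum_image hinj]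
  refine Finset.sum_congr rfl fun d hd => ?_
  rw [hback d hd]

/-! ### Poisson summation and completion: Drappeau's (4.33) -/

/-- **Drappeau 2017, §4.3.3, display (4.33)** (Poisson summation in `d ≡ d₀ (mod q)` followed by
completion of the reduced residues modulo `sc` to Kloosterman sums).  Let `q ≥ 1`, `sc ≥ 1`,
`(qr, sc) = 1`, `d₀, n ∈ ℕ`, and let `F : ℝ → ℂ` be smooth, compactly supported, vanishing at the
integers outside `[1, L]`.  Then
`∑_{1 ≤ d ≤ L, d ≡ d₀ (q), (qrd, sc) = 1} F(d) e(n·\overline{rd}/(sc))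
  = (q·sc)⁻¹ ∑_{h ∈ ℤ} 𝓕F(h/(q·sc)) · e(h d₀ \overline{sc}/q) · S(h q̄, n r̄; sc)`
with `\overline{rd}` the inverse of `rd` modulo `sc` (as in
`Literature.NumberTheory.Sieve.AssingBlomerLi2020_theorem23`), `\overline{sc} = (sc)⁻¹ (mod q)`,
`q̄ = q⁻¹`, `r̄ = r⁻¹ (mod sc)`, `S(a, b; m) = kloostermanSum m a b`, and Mathlib's
`𝓕F(ξ) = ∫ F(x) e(−xξ) dx` (so `h = −m` compared with the source).
[cite: Drappeau2017, §4.3.3 (4.33)] -/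
theorem poisson_completion {F : ℝ → ℂ} (hF : ContDiff ℝ ∞ F) (hFc : HasCompactSupport F) {L : ℕ}
    (hFL : ∀ m : ℤ, F m ≠ 0 → 1 ≤ m ∧ m ≤ L) {q r s c : ℕ} (hq : 0 < q) [NeZero (s * c)]
    (hcop : Nat.Coprime (q * r) (s * c)) (d₀ n : ℕ) :
    ∑ d ∈ Finset.Icc 1 L,
        (if d ≡ d₀ [MOD q] ∧ Nat.Coprime (q * r * d) (s * c) then
          F d * (𝐞 ((n : ℝ) * ((((r * d : ℕ) : ZMod (s * c))⁻¹).val : ℝ) / ((s : ℝ) * c)) : ℂ)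
        else 0) =
      ((q * (s * c) : ℕ) : ℂ)⁻¹ * ∑' h : ℤ, 𝓕 F ((h : ℝ) / (q * (s * c) : ℕ)) *
        ((𝐞 ((h : ℝ) * d₀ * (((((s * c : ℕ) : ZMod q)⁻¹).val : ℕ) : ℝ) / q) : ℂ) *
          kloostermanSum (s * c) ((h : ZMod (s * c)) * ((q : ZMod (s * c)))⁻¹)
            ((n : ZMod (s * c)) * ((r : ZMod (s * c)))⁻¹)) := by
  classical
  have hsc : 0 < s * c := Nat.pos_of_ne_zero (NeZero.ne _)
  haveI : NeZero q := ⟨hq.ne'⟩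
  set N : ℕ := s * c with hN
  have hqN : q.Coprime N := Nat.Coprime.coprime_dvd_left (dvd_mul_right q r) hcop
  have hrN : r.Coprime N := Nat.Coprime.coprime_dvd_left (dvd_mul_left r q) hcop
  have hr_unit : IsUnit (r : ZMod N) := (ZMod.isUnit_iff_coprime r N).mpr hrN
  -- the twisting function `G(x) = 1_{(x,N)=1} e_N(n r̄ x̄)`, `N`-periodic
  set G : ℤ → ℂ := fun x => if IsUnit (x : ZMod N) then
      (ZMod.stdAddChar ((n : ZMod N) * (r : ZMod N)⁻¹ * (x : ZMod N)⁻¹) : ℂ) else 0 with hG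
  have hGper : ∀ m k : ℤ, G (m + N * k) = G m := by
    intro m k
    have : ((m + N * k : ℤ) : ZMod N) = (m : ZMod N) := by
      push_cast; rw [ZMod.natCast_self, zero_mul, add_zero]
    simp only [hG, this]
  set Φ : ℤ → ℂ := fun m => F m * G m with hΦ
  have hΦL : ∀ m : ℤ, Φ m ≠ 0 → 1 ≤ m ∧ m ≤ L := fun m hm =>
    hFL m (mul_ne_zero_iff.mp hm).1
  -- Step A: the summand of the theorem is `1_{d ≡ d₀} Φ(d)`
  have hsummand : ∀ d ∈ Finset.Icc 1 L,
      (if d ≡ d₀ [MOD q] ∧ Nat.Coprime (q * r * d) N then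
          F d * (𝐞 ((n : ℝ) * ((((r * d : ℕ) : ZMod N)⁻¹).val : ℝ) / ((s : ℝ) * c)) : ℂ) else 0) =
      if d ≡ d₀ [MOD q] then Φ d else 0 := by
    intro d _
    by_cases hmod : d ≡ d₀ [MOD q]
    · rw [if_pos hmod]
      by_cases hcd : Nat.Coprime (q * r * d) N
      · rw [if_pos ⟨hmod, hcd⟩]
        have hdN : d.Coprime N := (Nat.coprime_mul_iff_left.mp hcd).2
        have hd_unit : IsUnit ((d : ℕ) : ZMod N) := (ZMod.isUnit_iff_coprime d N).mpr hdN
        have hΦd : Φ d = F d * (ZMod.stdAddChar ((n : ZMod N) * (r : ZMod N)⁻¹ *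
            ((d : ℕ) : ZMod N)⁻¹) : ℂ) := by
          simp only [hΦ, hG, Int.cast_natCast, hd_unit, if_true]
        rw [hΦd]
        congr 1
        -- the phase `e(n \overline{rd}/(sc)) = e_N(n r̄ d̄)`
        have hinv : (((r * d : ℕ) : ZMod N))⁻¹ = (r : ZMod N)⁻¹ * ((d : ℕ) : ZMod N)⁻¹ := by
          obtain ⟨ur, hur⟩ := hr_unit
          obtain ⟨ud, hud⟩ := hd_unit
          rw [Nat.cast_mul, ← hur, ← hud, ← Units.val_mul, ZMod.inv_coe_unit,
            ZMod.inv_coe_unit, ZMod.inv_coe_unit, mul_inv_rev, Units.val_mul, mul_comm]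
        have hprod : (n : ZMod N) * (r : ZMod N)⁻¹ * ((d : ℕ) : ZMod N)⁻¹ =
            (((n * ((((r * d : ℕ) : ZMod N))⁻¹).val : ℕ) : ℤ) : ZMod N) := by
          rw [Int.cast_natCast, Nat.cast_mul, ZMod.natCast_zmod_val, hinv, mul_assoc]
        rw [hprod, ZMod.stdAddChar_coe, Real.fourierChar_apply]
        congr 1
        have hNr : (N : ℂ) = (s : ℂ) * c := by rw [hN, Nat.cast_mul]
        rw [hNr]
        push_cast
        ring
      · rw [if_neg (fun h => hcd h.2)]
        have hdN : ¬ d.Coprime N := fun h => hcd (Nat.Coprime.mul_left hcop h)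
        have hd_unit : ¬ IsUnit ((d : ℤ) : ZMod N) := by
          rw [Int.cast_natCast, ZMod.isUnit_iff_coprime]; exact hdN
        simp only [hΦ, hG, hd_unit, if_false, mul_zero]
    · rw [if_neg (fun h => hmod h.1), if_neg hmod]
  rw [Finset.sum_congr rfl hsummand, sum_Icc_modEq_eq_tsum hΦL hq d₀]
  -- Step B: Poisson summation twisted by the `N`-periodic `G`
  have hΦk : ∀ k : ℤ, Φ (d₀ + q * k) = F ((d₀ : ℤ) + q * k) * G ((d₀ : ℤ) + q * k) := by
    intro k
    simp only [hΦ]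
    push_cast
    ring_nf
  rw [tsum_congr hΦk, MatomakiMerikoski2023_lemma34 hF hFc hq hsc (d₀ : ℤ) hGper]
  -- Step C: completion and reciprocity, frequency by frequency
  congr 1
  refine tsum_congr fun h => ?_
  congr 1
  have hinner := exact_completeSum_eq (d := N) hq hqN (d₀ : ℤ) h
    ((n : ZMod N) * (r : ZMod N)⁻¹)
  simp only [hG]
  rw [hinner, fourierChar_reciprocity hq hqN (d₀ : ℤ) h]
  simp only [Int.cast_natCast]
  rfl

end KloostermanQuintilinear

end Literature.NumberTheory.Sieve

end
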